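import Summits.CriticalPhenomena.PercolationContinuityZ3.Theorems.Transplant.GridCoverNets
import Summits.CriticalPhenomena.PercolationContinuityZ3.Theorems.Transplant.PlanarSkeletonFrmScaledDefs
import HarnessLib

/-!
# The `nbo` net (NbO) carries NO planar unit-step skeleton — `PlanarSkeletonFrm`, `PlanarSkeletonNeg`, `PlanarSkeletonSign`,
# `PlanarSkeletonConc` are EMPTY for EVERY chart (a kernel method-void certificate by the rectangle law on four hexagons)

builds on p205010 (kernel theorem, internal audit signed; external expert review pending) — nothing in this file uses p205010.
Lane `prim-bschramm`, seat `prim-bschramm-p4` (gen 19; PART C3, `HOME/bschramm/P4-GENERAL.md` §41).  Helper file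
(`--supports stmt-CriticalPhenomena-4575 --as helper`).

THE NET.  `nbo` = the NbO structure read as a 4-connected net: the points of `ℤ³` with exactly one or exactly two odd coordinates, nearest-
neighbour bonds (each site is square-planar: it moves along the two axes other than its "special" one).  Translation lattice `T` = bcc
(`(2,0,0), (0,2,0), (1,1,1)`), three classes (special axis `x, y, z`; representatives `(1,0,0), (0,1,0), (0,0,1)`).  Integer model on `ℤ³`:
the site `(n₁, n₂, 3 n₃ + c)` stands for `r_c + n₁ (2,0,0) + n₂ (0,2,0) + n₃ (1,1,1)`; the bond table `Nbo.bonds` (class `c = x₂ mod 3`) is the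
image of the four geometric bonds.  4-regular (`Nbo.degree_eq`); coordination sequence `4, 12, 28, 50, 76, 110, 148, …` = RCSR `nbo` (checked
numerically in the seat, `HOME/prim-bschramm-p4-g19/cover/`).
THE CERTIFICATE.  Let `φ` carry the field (ι).  At the site `v = (0,0,0)` (geometrically `(0,1,1)`, special axis `x`) call `b₊, b₋, c₊, c₋` the
codes of the four darts (towards the `±y` and `±z` neighbours).  The four hexagons of the net through `v` on the side `x ≤ 0` (the equators of
the four unit cubes at `v` with `x ∈ [−1, 0]`) have first steps `(b_±, s, c_±)` with ONE common second code `s` (shared darts, hexagon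
antipodality), so the rectangle law holds for all four triples `(b₊,s,c₊), (b₊,s,c₋), (b₋,s,c₊), (b₋,s,c₋)` with `b₊, b₋, c₊, c₋` pairwise
distinct — impossible (`GridCover.nbo_codes_false`, `decide` over `4⁵` codes).  Hence **`Nbo.isEmpty_planarSkeletonFrm`**, `…Neg`, `…Sign`,
`…Conc`: the lane's entry "nbo: method-void (no AFFINE chart passes (ι))" (P2-LATTICES §49) now holds for ALL charts, as a kernel theorem.
(Site symmetry `4/mmm` does contain the inversion; it is the step field, not the symmetry, that fails.)
[cite: KozmaNitzan2024, §4 p. 15 (outward steps), p. 16 (Lemma 8)] [cite: ConwaySloane1999, Ch. 4 §7.1 (cubic lattices and their sublattices)]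
-/

namespace Summit.CriticalPhenomena.PercolationContinuityZ3.Theorems.Transplant

open Literature.Probability.Percolation Literature.Probability.LatticeModels SimpleGraph GridCover

namespace GridCover

/-- **The `nbo` code contradiction**: four pairwise distinct codes `b₊, b₋, c₊, c₋` and one code `s` cannot satisfy the rectangle law for all
four triples `(b_±, s, c_±)` (`decide` over `4⁵` codes). [folklore] -/
theorem nbo_codes_false : ∀ bp bm cp cm s : Fin 4, bp ≠ bm → bp ≠ cp → bp ≠ cm → bm ≠ cp → bm ≠ cm → cp ≠ cm →
    rect bp s cp = true → rect bp s cm = true → rect bm s cp = true → rect bm s cm = true → False := by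
  decide

end GridCover

namespace Nbo

/-! ## §1 The `nbo` graph on `ℤ³` -/

/-- The bond table of `nbo` (class `c = x₂ mod 3` = special axis `x, y, z`). [cite: ConwaySloane1999, Ch. 4 §7.1] -/
def bonds : Fin 3 → Finset (Site 3) :=
  ![{![0, -1, 4], ![1, 0, -2], ![1, 0, -1], ![1, 1, -1]},
    {![-1, 0, 2], ![0, 1, -4], ![0, 1, -2], ![1, 1, -2]},
    {![-1, -1, 1], ![-1, -1, 2], ![-1, 0, 1], ![0, -1, 2]}]

/-- No zero bond. [folklore] -/
theorem zero_notMem_bonds : ∀ c, (0 : Site 3) ∉ bonds c := by decide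

/-- **The bond table is symmetric.** [folklore] -/
theorem neg_mem_bonds : ∀ c, ∀ v ∈ bonds c, -v ∈ bonds (TableNet.tgt 2 c v) := by decide

/-- Four bonds at every site. [folklore] -/
theorem card_bonds : ∀ c, (bonds c).card = 4 := by decide

/-- **The `nbo` graph.** [cite: ConwaySloane1999, Ch. 4 §7.1] -/
def graph : SimpleGraph (Site 3) := TableNet.graph 2 bonds

/-- The `nbo` graph is locally finite. [folklore] -/
noncomputable instance graph_locallyFinite : graph.LocallyFinite := TableNet.graph_locallyFinite

/-- **`nbo` is 4-regular.** [cite: ConwaySloane1999, Ch. 4 §7.1] -/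
theorem degree_eq (x : Site 3) : graph.degree x = 4 := TableNet.degree_eq zero_notMem_bonds neg_mem_bonds card_bonds x

/-- A table bond is an edge. [folklore] -/
theorem adj_of_mem {x y : Site 3} (h : y - x ∈ bonds (TableNet.cls 2 x)) : graph.Adj x y := TableNet.adj_of_mem zero_notMem_bonds h

/-! ## §2 The four hexagons through `v = (0,0,0)` on one side -/

/-- Hexagon 1: `v → (+y) → … → (+z) → v` (cube equator through `v, v+y, v+z`). [folklore] -/
noncomputable def hex1 : GridHexagon graph where
  v₀ := ![0, 0, 0]
  v₁ := ![1, 1, -1]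
  v₂ := ![0, 0, 1]
  v₃ := ![-1, 0, 3]
  v₄ := ![0, 0, 2]
  v₅ := ![0, -1, 4]
  h₀₁ := adj_of_mem (by decide)
  h₁₂ := adj_of_mem (by decide)
  h₂₃ := adj_of_mem (by decide)
  h₃₄ := adj_of_mem (by decide)
  h₄₅ := adj_of_mem (by decide)
  h₅₀ := adj_of_mem (by decide)
  n₀₂ := by decide
  n₁₃ := by decide
  n₂₄ := by decide
  n₃₅ := by decide
  n₄₀ := by decide
  n₅₁ := by decide
  d₀ := (degree_eq _).le
  d₁ := (degree_eq _).le
  d₂ := (degree_eq _).le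
  d₃ := (degree_eq _).le
  d₄ := (degree_eq _).le
  d₅ := (degree_eq _).le

/-- Hexagon 2: `v → (+y) → … → (−z) → v`. [folklore] -/
noncomputable def hex2 : GridHexagon graph where
  v₀ := ![0, 0, 0]
  v₁ := ![1, 1, -1]
  v₂ := ![0, 0, 1]
  v₃ := ![0, 1, -3]
  v₄ := ![1, 1, -4]
  v₅ := ![1, 0, -2]
  h₀₁ := adj_of_mem (by decide)
  h₁₂ := adj_of_mem (by decide)
  h₂₃ := adj_of_mem (by decide)
  h₃₄ := adj_of_mem (by decide)
  h₄₅ := adj_of_mem (by decide)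
  h₅₀ := adj_of_mem (by decide)
  n₀₂ := by decide
  n₁₃ := by decide
  n₂₄ := by decide
  n₃₅ := by decide
  n₄₀ := by decide
  n₅₁ := by decide
  d₀ := (degree_eq _).le
  d₁ := (degree_eq _).le
  d₂ := (degree_eq _).le
  d₃ := (degree_eq _).le
  d₄ := (degree_eq _).le
  d₅ := (degree_eq _).le

/-- Hexagon 3: `v → (−y) → … → (+z) → v`. [folklore] -/
noncomputable def hex3 : GridHexagon graph where
  v₀ := ![0, 0, 0]
  v₁ := ![1, 0, -1]
  v₂ := ![0, -1, 1]
  v₃ := ![-1, -1, 3]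
  v₄ := ![0, 0, 2]
  v₅ := ![0, -1, 4]
  h₀₁ := adj_of_mem (by decide)
  h₁₂ := adj_of_mem (by decide)
  h₂₃ := adj_of_mem (by decide)
  h₃₄ := adj_of_mem (by decide)
  h₄₅ := adj_of_mem (by decide)
  h₅₀ := adj_of_mem (by decide)
  n₀₂ := by decide
  n₁₃ := by decide
  n₂₄ := by decide
  n₃₅ := by decide
  n₄₀ := by decide
  n₅₁ := by decide
  d₀ := (degree_eq _).le
  d₁ := (degree_eq _).le
  d₂ := (degree_eq _).le
  d₃ := (degree_eq _).le
  d₄ := (degree_eq _).le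
  d₅ := (degree_eq _).le

/-- Hexagon 4: `v → (−y) → … → (−z) → v`. [folklore] -/
noncomputable def hex4 : GridHexagon graph where
  v₀ := ![0, 0, 0]
  v₁ := ![1, 0, -1]
  v₂ := ![0, -1, 1]
  v₃ := ![0, 0, -3]
  v₄ := ![1, 1, -4]
  v₅ := ![1, 0, -2]
  h₀₁ := adj_of_mem (by decide)
  h₁₂ := adj_of_mem (by decide)
  h₂₃ := adj_of_mem (by decide)
  h₃₄ := adj_of_mem (by decide)
  h₄₅ := adj_of_mem (by decide)
  h₅₀ := adj_of_mem (by decide)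
  n₀₂ := by decide
  n₁₃ := by decide
  n₂₄ := by decide
  n₃₅ := by decide
  n₄₀ := by decide
  n₅₁ := by decide
  d₀ := (degree_eq _).le
  d₁ := (degree_eq _).le
  d₂ := (degree_eq _).le
  d₃ := (degree_eq _).le
  d₄ := (degree_eq _).le
  d₅ := (degree_eq _).le

/-! ## §3 The certificate -/

/-- **No chart on `nbo` has the outward-step field (ι).** [cite: KozmaNitzan2024, §4 p. 15] -/
theorem false_of_unitSteps {φ : Site 3 → Site 2}
    (hstep : ∀ (v : Site 3) (i : Fin 2) (σ : ℤˣ), ∃ v' : Site 3, graph.Adj v v' ∧ φ v' = φ v + Pi.single i (σ : ℤ)) : False := by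
  obtain ⟨a0, a1, a2, ha0, ha1, -, -, ha4, ha5, pa⟩ := hex1.rect hstep
  obtain ⟨b0, b1, b2, hb0, hb1, -, -, -, hb5, pb⟩ := hex2.rect hstep
  obtain ⟨c0, c1, c2, hc0, hc1, -, -, hc4, hc5, pc⟩ := hex3.rect hstep
  obtain ⟨d0, d1, d2, hd0, hd1, -, -, -, hd5, pd⟩ := hex4.rect hstep
  -- shared darts: `hex2` starts like `hex1`; `hex3`/`hex1` share the closing darts; `hex4` starts like `hex3` and closes like `hex2`
  have e_b0 : b0 = a0 := code_unique hb0 ha0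
  have e_b1 : b1 = a1 := code_unique hb1 ha1
  have e_c2 : c2 = a2 := opp_injective (code_unique hc5 ha5)
  have e_c1 : c1 = a1 := opp_injective (code_unique hc4 ha4)
  have e_d0 : d0 = c0 := code_unique hd0 hc0
  have e_d1 : d1 = a1 := (code_unique hd1 hc1).trans e_c1
  have e_d2 : d2 = b2 := opp_injective (code_unique hd5 hb5)
  rw [e_b0, e_b1] at pb
  rw [e_c1, e_c2] at pc
  rw [e_d0, e_d1, e_d2] at pd
  -- the four darts at `v = (0,0,0)` carry the codes `a0, c0, a2, b2`, pairwise distinct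
  have hcp : φ hex1.v₅ - φ hex1.v₀ = vec a2 := by rw [← opp_opp a2, vec_opp, ← ha5, neg_sub]
  have hcm : φ hex2.v₅ - φ hex2.v₀ = vec b2 := by rw [← opp_opp b2, vec_opp, ← hb5, neg_sub]
  have v0 := (degree_eq hex1.v₀).le
  have n1 := code_ne_of_ne hstep v0 hex1.h₀₁ hex3.h₀₁ (by decide) ha0 hc0
  have n2 := code_ne_of_ne hstep v0 hex1.h₀₁ hex1.h₅₀.symm (by decide) ha0 hcp
  have n3 := code_ne_of_ne hstep v0 hex1.h₀₁ hex2.h₅₀.symm (by decide) ha0 hcm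
  have n4 := code_ne_of_ne hstep v0 hex3.h₀₁ hex1.h₅₀.symm (by decide) hc0 hcp
  have n5 := code_ne_of_ne hstep v0 hex3.h₀₁ hex2.h₅₀.symm (by decide) hc0 hcm
  have n6 := code_ne_of_ne hstep v0 hex1.h₅₀.symm hex2.h₅₀.symm (by decide) hcp hcm
  exact nbo_codes_false a0 c0 a2 b2 a1 n1 n2 n3 n4 n5 n6 pa pb pc pd

/-- **THEOREM (kernel no-go): `nbo` carries no `PlanarSkeletonFrm`** (frames-only; so N2 / U have no `nbo` customer through any chart).
[cite: KozmaNitzan2024, §4 p. 15] -/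
theorem isEmpty_planarSkeletonFrm : IsEmpty (PlanarSkeletonFrm graph) := ⟨fun Φ => false_of_unitSteps Φ.step⟩

/-- **… no `PlanarSkeletonNeg`.** [cite: KozmaNitzan2024, §4 p. 16 (Lemma 8)] -/
theorem isEmpty_planarSkeletonNeg : IsEmpty (PlanarSkeletonNeg graph) := ⟨fun Φ => false_of_unitSteps Φ.step⟩

/-- **… no `PlanarSkeletonSign`** (the CLOSED D″ node does not reach `nbo` through any chart). [cite: KozmaNitzan2024, §4 p. 16 (Lemma 8)] -/
theorem isEmpty_planarSkeletonSign : IsEmpty (PlanarSkeletonSign graph) := ⟨fun Φ => false_of_unitSteps Φ.step⟩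

/-- **… and no `PlanarSkeletonConc`.** [cite: KozmaNitzan2024, §4 p. 16 (Lemma 8)] -/
theorem isEmpty_planarSkeletonConc : IsEmpty (PlanarSkeletonConc graph) := ⟨fun Φ => false_of_unitSteps Φ.step⟩

/-- **… no `PlanarSkeletonFrmFrom`** (the universal one-type node U's interface). [cite: KozmaNitzan2024, §4 p. 15] -/
theorem isEmpty_planarSkeletonFrmFrom : IsEmpty (PlanarSkeletonFrmFrom graph) := ⟨fun Φ => false_of_unitSteps Φ.step⟩

/-- **… and no `PlanarSkeletonFrmScaled` — for ANY step length `N` and ANY Lipschitz constant**: the coarse chart `⌊φ/N⌋` of a scaled skeleton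
has unit steps (`PlanarSkeletonFrmScaled.steps_coarse`) and the certificate uses nothing but the steps; so no multi-type version of the scaled
node could reach this net either — it needs QUASI-steps (steps along bounded paths). [cite: KozmaNitzan2024, §4 p. 15] -/
theorem isEmpty_planarSkeletonFrmScaled : IsEmpty (PlanarSkeletonFrmScaled graph) := ⟨fun Φ => false_of_unitSteps Φ.steps_coarse⟩

end Nbo

end Summit.CriticalPhenomena.PercolationContinuityZ3.Theorems.Transplant
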